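import Mathlib.Order.Filter.CountablyGenerated
import Mathlib.Topology.Algebra.Group.Basic
import Literature.AnabelianGeometry.SemiGraphs.TemperoidsHomTorsor

/-!
# [SemiAnbd] Proposition 3.2: the homomorphism `Π₁ → Π₂` of a morphism of connected temperoids

Mochizuki, *Semi-graphs of anabelioids*, Publ. RIMS **42** (2006) 221–322, §3, Proposition 3.2,
author's manuscript p. 35 [cite: MochizukiSemiAnbd2006, Prop 3.2 p.35].  Proof-only tool file (no
definitions) towards the named fact `TemperoidHomEqRes` of `Temperoids.lean`.  For a functor
`F : B^temp(Π₂) ⥤ B^temp(Π₁)` preserving finite limits and countable colimits, `Π₂` tempered and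
second countable (the Galois-countability hypothesis (E7) of [IUTchI] Rmk. 2.5.3): we choose a
cofinal decreasing sequence `N₀ ⊇ N₁ ⊇ …` of open normal subgroups of `Π₂`, compatible base
points `y_k` of the torsors `Y_k = F(Π₂/N_k)` (`TemperoidsHomTorsor.lean`), and obtain the
continuous homomorphism `φ : Π₁ → Π₂` characterised by `a · y_k = y_k · φ(a)` for all `k`
(`exists_continuousMonoidHom`): at each level `a ↦` the unique coset moving `y_k` to `a · y_k`
is a homomorphism `Π₁ → Π₂/N_k`, continuous since the stabiliser of `y_k` is open; the levels
are compatible and glue by the completeness of the tempered group `Π₂` (Definition 3.1 (i)).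
-/

namespace Literature.AnabelianGeometry.SemiGraphs

namespace BTemp

open CategoryTheory CategoryTheory.Limits Topology Filter

universe u

section Bookkeeping

variable {G : Type u} [Group G] [TopologicalSpace G]

/-- Morphisms of `B^temp(Π)` are determined by their underlying maps. [folklore] -/
private theorem hom_ext'' {X Y : BTemp G} (f g : X ⟶ Y) (h : ∀ x, f.hom.hom x = g.hom.hom x) :
    f = g := by
  apply ObjectProperty.hom_ext
  apply Action.Hom.ext
  exact ConcreteCategory.hom_ext _ _ h

/-- The action of a `Π`-set is multiplicative on elements. [folklore] -/
private theorem ρ_mul_apply' (X : BTemp G) (g h : G) (x : X.obj.V) :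
    X.obj.ρ (g * h) x = X.obj.ρ g (X.obj.ρ h x) := by
  rw [map_mul]
  rfl

/-- The action of `1` is the identity on elements. [folklore] -/
private theorem ρ_one_apply' (X : BTemp G) (x : X.obj.V) : X.obj.ρ 1 x = x := by
  rw [map_one]
  rfl

variable [IsTopologicalGroup G] (hG : IsTempered G)

/-- The projection `Π/N → Π/N` is the identity. [cite: MochizukiSemiAnbd2006, Rmk 3.1.2 p.33] -/
theorem proj_self (N : OpenNormalSubgroup G) (h : N ≤ N) : proj hG h = 𝟙 (Q hG N) := by
  apply hom_ext''
  intro q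
  obtain ⟨z, rfl⟩ := QuotientGroup.mk_surjective q
  rw [proj_apply]
  rfl

/-- Projections compose. [cite: MochizukiSemiAnbd2006, Rmk 3.1.2 p.33] -/
theorem proj_comp {N M L : OpenNormalSubgroup G} (h₁ : N ≤ M) (h₂ : M ≤ L) :
    proj hG h₁ ≫ proj hG h₂ = proj hG (h₁.trans h₂) := by
  apply hom_ext''
  intro q
  obtain ⟨z, rfl⟩ := QuotientGroup.mk_surjective q
  change (proj hG h₂).hom.hom ((proj hG h₁).hom.hom (z : G ⧸ N.toSubgroup)) = _
  rw [proj_apply, proj_apply, proj_apply]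

end Bookkeeping

variable {G₁ : Type u} [Group G₁] [TopologicalSpace G₁] [IsTopologicalGroup G₁]
  {G₂ : Type u} [Group G₂] [TopologicalSpace G₂] [IsTopologicalGroup G₂]
  [SecondCountableTopology G₂] (hG₂ : IsTempered G₂)
  (F : BTemp G₂ ⥤ BTemp G₁) (hlim : PreservesFiniteLimits F)
  (hcolim : ∀ (J : Type) [SmallCategory J] [CountableCategory J], PreservesColimitsOfShape J F)

include hlim hcolim in
/-- **The homomorphism of Proposition 3.2.**  There are a cofinal decreasing sequence `N_k` of open
normal subgroups of `Π₂`, compatible base points `y_k ∈ F(Π₂/N_k)` and a continuous homomorphism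
`φ : Π₁ → Π₂` such that `a · y_k = F(r_{φ(a)}) y_k` for all `k` and all `a ∈ Π₁`.
[cite: MochizukiSemiAnbd2006, Prop 3.2 p.35] -/
theorem exists_continuousMonoidHom :
    ∃ (φ : G₁ →ₜ* G₂) (N : ℕ → OpenNormalSubgroup G₂) (y : ∀ k, (F.obj (Q hG₂ (N k))).obj.V),
      Antitone N ∧ (∀ U ∈ 𝓝 (1 : G₂), ∃ k, (N k : Set G₂) ⊆ U) ∧
      (∀ j k, j ≤ k → ∀ h : N k ≤ N j, (F.map (proj hG₂ h)).hom.hom (y k) = y j) ∧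
      ∀ (k : ℕ) (a : G₁), (F.obj (Q hG₂ (N k))).obj.ρ a (y k) =
        (F.map (rightMul hG₂ (N k) (φ a))).hom.hom (y k) := by
  classical
  -- (1) a cofinal decreasing sequence of open normal subgroups
  obtain ⟨N, -, hNb⟩ := hG₂.hasBasis_nhds_one.exists_antitone_subbasis
  have hNanti : Antitone N := fun j k hjk => SetLike.coe_subset_coe.mp (hNb.antitone hjk)
  have hNbasis : ∀ U ∈ 𝓝 (1 : G₂), ∃ k, (N k : Set G₂) ⊆ U := fun U hU => hNb.mem_iff.mp hU
  have hkU : ∀ M : OpenNormalSubgroup G₂, ∃ k, N k ≤ M := fun M => by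
    obtain ⟨k, hk⟩ := hNbasis (M : Set G₂) M.toOpenSubgroup.mem_nhds_one
    exact ⟨k, SetLike.coe_subset_coe.mp hk⟩
  let kOf : OpenNormalSubgroup G₂ → ℕ := fun M => Classical.choose (hkU M)
  have hkOf : ∀ M, N (kOf M) ≤ M := fun M => Classical.choose_spec (hkU M)
  -- (2) compatible base points
  have hsurjproj : ∀ (k : ℕ) (t : (F.obj (Q hG₂ (N k))).obj.V),
      ∃ s : (F.obj (Q hG₂ (N (k + 1)))).obj.V,
        (F.map (proj hG₂ (hNanti (Nat.le_succ k)))).hom.hom s = t := by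
    intro k t
    have hN' := le_stab_quotientObj_one hG₂ (N (k + 1)) (N k).toSubgroup (N k).isOpen'
      (hNanti (Nat.le_succ k))
    rw [proj_eq_orbitMap hG₂ (hNanti (Nat.le_succ k)) hN']
    exact (map_orbitMap hG₂ F hcolim (N (k + 1)) (Q hG₂ (N k)) _
      (quotientObj_transitive hG₂ (N k).toSubgroup (N k).isOpen') hN').1 t
  obtain ⟨y0⟩ := (fibreQ_transitive hG₂ F hlim hcolim (N 0)).1
  let y : ∀ k, (F.obj (Q hG₂ (N k))).obj.V := fun k =>
    Nat.rec (motive := fun k => (F.obj (Q hG₂ (N k))).obj.V) y0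
      (fun k yk => Classical.choose (hsurjproj k yk)) k
  have hy : ∀ k, (F.map (proj hG₂ (hNanti (Nat.le_succ k)))).hom.hom (y (k + 1)) = y k :=
    fun k => Classical.choose_spec (hsurjproj k (y k))
  have hycompat : ∀ j k, j ≤ k → ∀ h : N k ≤ N j, (F.map (proj hG₂ h)).hom.hom (y k) = y j := by
    intro j k hjk
    induction k, hjk using Nat.le_induction with
    | base => intro h; rw [proj_self, F.map_id]; rfl
    | succ k hjk ih =>
      intro h
      rw [← proj_comp hG₂ (hNanti (Nat.le_succ k)) (hNanti hjk), F.map_comp]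
      change (F.map (proj hG₂ (hNanti hjk))).hom.hom
        ((F.map (proj hG₂ (hNanti (Nat.le_succ k)))).hom.hom (y (k + 1))) = y j
      rw [hy k, ih]
  -- (3) the level-`k` maps `ψ k : Π₁ → Π₂` with `a · y_k = F(r_{ψ k a}) y_k`
  have htrans := fun k => (fibreQ_transitive hG₂ F hlim hcolim (N k)).2
  let ψ : ℕ → G₁ → G₂ := fun k a =>
    Classical.choose (htrans k (y k) ((F.obj (Q hG₂ (N k))).obj.ρ a (y k)))
  have hψ : ∀ k a, (F.map (rightMul hG₂ (N k) (ψ k a))).hom.hom (y k) =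
      (F.obj (Q hG₂ (N k))).obj.ρ a (y k) :=
    fun k a => Classical.choose_spec (htrans k (y k) ((F.obj (Q hG₂ (N k))).obj.ρ a (y k)))
  have hψmul : ∀ k a b, ((ψ k (a * b) : G₂) : G₂ ⧸ (N k).toSubgroup) =
      ((ψ k a * ψ k b : G₂) : G₂ ⧸ (N k).toSubgroup) := by
    intro k a b
    apply fibreQ_coe_eq_of_rightMul_eq hG₂ F hlim hcolim (N k) (y := y k)
    rw [hψ k (a * b), ρ_mul_apply', ← hψ k b, ← hom_hom_ρ, ← hψ k a, ← rightMul_comp,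
      F.map_comp]
    rfl
  have hψsucc : ∀ k a, ((ψ (k + 1) a : G₂) : G₂ ⧸ (N k).toSubgroup) = ψ k a := by
    intro k a
    apply fibreQ_coe_eq_of_rightMul_eq hG₂ F hlim hcolim (N k) (y := y k)
    rw [hψ k a, ← hy k, ← hom_hom_ρ, ← hψ (k + 1) a]
    change (F.map (proj hG₂ (hNanti (Nat.le_succ k))) ≫
        F.map (rightMul hG₂ (N k) (ψ (k + 1) a))).hom.hom (y (k + 1)) =
      (F.map (rightMul hG₂ (N (k + 1)) (ψ (k + 1) a)) ≫
        F.map (proj hG₂ (hNanti (Nat.le_succ k)))).hom.hom (y (k + 1))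
    rw [← F.map_comp, ← F.map_comp, rightMul_proj]
  have hcompat : ∀ j k, j ≤ k → ∀ a, ((ψ k a : G₂) : G₂ ⧸ (N j).toSubgroup) = ψ j a := by
    intro j k hjk a
    induction k, hjk using Nat.le_induction with
    | base => rfl
    | succ k hjk ih =>
      rw [← ih, QuotientGroup.eq]
      have h1 := (QuotientGroup.eq (s := (N k).toSubgroup)).mp (hψsucc k a)
      exact hNanti hjk h1
  -- (4) glue the levels by completeness of `Π₂`
  have hcomplete : ∀ a : G₁, ∃ g : G₂, ∀ M : OpenNormalSubgroup G₂,
      ((ψ (kOf M) a : G₂) : G₂ ⧸ M.toSubgroup) = (g : G₂ ⧸ M.toSubgroup) := by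
    intro a
    apply hG₂.complete (fun M => ((ψ (kOf M) a : G₂) : G₂ ⧸ M.toSubgroup))
    intro M M' hMM' g hg
    rw [QuotientGroup.eq] at hg ⊢
    have h1 : (ψ (kOf M') a)⁻¹ * ψ (max (kOf M) (kOf M')) a ∈ M'.toSubgroup :=
      hkOf M' ((QuotientGroup.eq (s := (N (kOf M')).toSubgroup)).mp
        (hcompat _ _ (le_max_right (kOf M) (kOf M')) a).symm)
    have h2 : (ψ (max (kOf M) (kOf M')) a)⁻¹ * ψ (kOf M) a ∈ M'.toSubgroup :=
      hMM' (hkOf M ((QuotientGroup.eq (s := (N (kOf M)).toSubgroup)).mp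
        (hcompat _ _ (le_max_left (kOf M) (kOf M')) a)))
    have h3 : (ψ (kOf M) a)⁻¹ * g ∈ M'.toSubgroup := hMM' hg
    have h4 := M'.toSubgroup.mul_mem (M'.toSubgroup.mul_mem h1 h2) h3
    simpa only [mul_assoc, mul_inv_cancel_left] using h4
  let φfun : G₁ → G₂ := fun a => Classical.choose (hcomplete a)
  have hφ : ∀ a M, ((ψ (kOf M) a : G₂) : G₂ ⧸ M.toSubgroup) = (φfun a : G₂ ⧸ M.toSubgroup) :=
    fun a => Classical.choose_spec (hcomplete a)
  have hφψ : ∀ k a, ((φfun a : G₂) : G₂ ⧸ (N k).toSubgroup) = ψ k a := by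
    intro k a
    rw [← hφ a (N k)]
    -- both `ψ (kOf (N k)) a` and `ψ k a` agree with `ψ K a` modulo `N k`, `K` large
    have h1 : ((ψ (max k (kOf (N k))) a : G₂) : G₂ ⧸ (N k).toSubgroup) = ψ k a :=
      hcompat _ _ (le_max_left _ _) a
    have h2 : ((ψ (max k (kOf (N k))) a : G₂) : G₂ ⧸ (N (kOf (N k))).toSubgroup) =
        ψ (kOf (N k)) a :=
      hcompat _ _ (le_max_right _ _) a
    rw [← h1, QuotientGroup.eq]
    exact hkOf (N k) ((QuotientGroup.eq (s := (N (kOf (N k))).toSubgroup)).mp h2.symm)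
  -- (5) `φ` is a homomorphism (by separatedness of `Π₂`)
  have hφmul : ∀ a b, φfun (a * b) = φfun a * φfun b := by
    intro a b
    by_contra hne
    have hne' : (φfun a * φfun b)⁻¹ * φfun (a * b) ≠ 1 := by
      intro h
      apply hne
      rw [inv_mul_eq_one] at h
      exact h.symm
    obtain ⟨M, hM⟩ := hG₂.separated _ hne'
    apply hM
    have h1 : ((φfun a * φfun b : G₂) : G₂ ⧸ (N (kOf M)).toSubgroup) =
        ((φfun (a * b) : G₂) : G₂ ⧸ (N (kOf M)).toSubgroup) := by
      rw [QuotientGroup.mk_mul, hφψ, hφψ, hφψ, ← QuotientGroup.mk_mul, hψmul]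
    exact hkOf M ((QuotientGroup.eq (s := (N (kOf M)).toSubgroup)).mp h1)
  let φ₀ : G₁ →* G₂ := MonoidHom.mk' φfun hφmul
  -- (6) `φ` is continuous (the stabiliser of `y_k` is open)
  have hcont : Continuous φ₀ := by
    apply continuous_of_continuousAt_one φ₀
    rw [ContinuousAt, map_one]
    refine (hG₂.hasBasis_nhds_one.tendsto_right_iff).mpr fun M _ => ?_
    have hopen : IsOpen {a : G₁ |
        (F.obj (Q hG₂ (N (kOf M)))).obj.ρ a (y (kOf M)) = y (kOf M)} :=
      (F.obj (Q hG₂ (N (kOf M)))).property.2 (y (kOf M))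
    have h1 : (1 : G₁) ∈ {a : G₁ |
        (F.obj (Q hG₂ (N (kOf M)))).obj.ρ a (y (kOf M)) = y (kOf M)} :=
      ρ_one_apply' _ _
    filter_upwards [hopen.mem_nhds h1] with a ha
    have h2 : ((ψ (kOf M) a : G₂) : G₂ ⧸ (N (kOf M)).toSubgroup) = ((1 : G₂) : _) := by
      apply fibreQ_coe_eq_of_rightMul_eq hG₂ F hlim hcolim (N (kOf M)) (y := y (kOf M))
      rw [hψ, rightMul_one, F.map_id]
      exact ha
    have h3 : φfun a ∈ (N (kOf M)).toSubgroup := by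
      rw [← QuotientGroup.eq_one_iff, hφψ, h2, QuotientGroup.mk_one]
    exact hkOf M h3
  -- (7) assemble
  refine ⟨⟨φ₀, hcont⟩, N, y, hNanti, hNbasis, hycompat, fun k a => ?_⟩
  rw [← hψ k a]
  exact congrArg (fun f => (F.map f).hom.hom (y k))
    (rightMul_eq_of_coe_eq hG₂ (N k) (hφψ k a).symm)

end BTemp

end Literature.AnabelianGeometry.SemiGraphs
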